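import Summits.QuantumFields.BalabanUV.T4Continuum.Support.NE7PairwiseCauchy

/-!
# NE7PairwiseCauchyWindow — row NE7 (node U5), route «PAIR-CAUCHY»: THE GOOD-CLASS WINDOW AS A FREE PARAMETER —
# a double limit (`K → ∞` at fixed window depth `w`, then `w → ∞`) instead of road P1's `K`-dependent log window

Cell `pub-balaban`, rung (B)+1 sub-cell t4, lineage `b2b-balaban-t4-ne7-p2` (CRUX PROVER NE7 #2 under the coordinator
ruling «YM redirect», 2026-08-21; generation 48; route text `HOME/t4/b2b-balaban-t4-ne7-p2/g48/ROUTE2-NE7-P2.md` §2).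
Companion of `Support/NE7PairwiseCauchy` (p247800).  HONEST FRAMING (page 1): FIXED FINITE T⁴, rung (B)+1, CONDITIONAL on
BetaPertH and the nine spine estimates (0/9 proved); NOT infinite volume, NOT a mass gap, NOT the Clay problem.  NE7 is
NOT PRINTED in [Balaban1984PropagatorsI]–[Balaban1989LargeFieldII] and NOT proved here.  [folklore] real analysis on
hypothesis shapes; no definition, no cite tag, nothing printed asserted, no `sorry`.

WHY.  On road P1 a history is GOOD iff all its regularity windows lie at the levels `j ∈ [jlogOf C K, K]`
(`T4GoodClassBudget`): the window GROWS with `K` so that the bad-class weights become summable, and the price is that the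
BOUNDARY kind of a good term — which carries no size contraction — must be matched across the two runs by a GEOMETRIC
rate `θ′^j` beating the window multiplicity `Λ^{K−j}` (`windowSum θ′ Λ (jlogOf C K) K`, `summable_windowSum_log`).  A merely
NULL two-run modulus cannot beat a multiplicity growing like a power of `K`.  On the route «PAIR-CAUCHY» the window depth
is instead a FREE, `K`-INDEPENDENT design parameter `w`: at fixed `w` the good-class discrepancy of a pair `K ≤ K′` is a
finite combination of null moduli (no growth in `K` to beat), hence null; the bad class (a large-field∕boundary degree of
freedom deeper than `w`) has relative weight eventually `≤ η w` with `η w → 0` as `w → ∞` — row NE7b's ask in QUALITATIVE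
form (deep bad classes are uniformly light), replacing `Summable W`; and the pair-Cauchy statement follows by choosing the
window AFTER `ε` and `K₀` after the window.

WHAT IS PROVED ([folklore]).  `cauchySeq_genFun_of_pairCauchy` (the `ε–K₀` form of pair matching ⟹ Cauchy generating
functions); **`pairCauchy_of_windowedHybrid`** (per window `w` and pair `K ≤ K′` a matching modulo constants with the hybrid
remainder `vol·D w K − log(1 − W w K)`, `D w · → 0` for each `w`, `W w K ≤ η w` eventually, `η w < 1`, `η → 0` ⟹ the
`ε–K₀` pair-Cauchy statement); **`genFunCauchy_of_windowedHybrid`** (node U6's `T4Assembly.GenFunCauchy S l₀` by name from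
the windowed data).

NOT DELIVERED: the windowed good classes for Bałaban's runs (NODE O) and the qualitative deep-bad-class weight bound
(row NE7b).  NOT NE7 (spine 0/9 unchanged), NOT summit progress.  HONEST DEPENDENCY: continuum YM on T⁴ ⇐ BetaPertH ∧
nine spine estimates (0/9 proved); BetaPertH ⇐ (D1) ∧ (D4) ∧ CAP+tail; G-an2-4 gates asym, D1 and NE2/3/4.
-/

noncomputable section

open Finset Filter Topology
open scoped BigOperators

namespace Summit.QuantumFields.BalabanUV.T4Continuum.NE7PairwiseCauchyWindow

open Literature.MathematicalPhysics.QuantumFieldTheory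
open Literature.MathematicalPhysics.QuantumFieldTheory.Balaban1983to89
open T4CauchySum (genFun)
open Summit.QuantumFields.BalabanUV.T4Continuum.NE7PairwiseCauchy (abs_genFun_sub_genFun_le_of_pair)

/-! ## §1 The `ε–K₀` form and the double limit -/

section Window

variable {vol l₀ : ℝ} {Z : ℕ → ℝ → ℝ}

/-- **PAIR-CAUCHY IN `ε–K₀` FORM.**  If for every `ε > 0` there is `K₀` such that all pairs `K₀ ≤ K ≤ K′` match modulo a
`t`-independent constant within `ε` on `|t| ≤ l₀` (`0 ≤ l₀`), then each `K ↦ genFun Z K t` is Cauchy. [folklore] -/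
theorem cauchySeq_genFun_of_pairCauchy (hl₀ : 0 ≤ l₀)
    (h : ∀ ε : ℝ, 0 < ε → ∃ K₀ : ℕ, ∀ K K' : ℕ, K₀ ≤ K → K ≤ K' →
      ∃ c : ℝ, ∀ t : ℝ, |t| ≤ l₀ → |Real.log (Z K' t) - Real.log (Z K t) - c| ≤ ε)
    {t : ℝ} (ht : |t| ≤ l₀) : CauchySeq fun K => genFun Z K t := by
  refine Metric.cauchySeq_iff'.2 fun ε hε => ?_
  obtain ⟨K₀, hK₀⟩ := h (ε / 4) (by linarith)
  refine ⟨K₀, fun n hn => ?_⟩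
  obtain ⟨c, hc⟩ := hK₀ K₀ n le_rfl hn
  have hb := abs_genFun_sub_genFun_le_of_pair (vol := 1) (D := fun _ => ε / 4) (K := K₀) hl₀
    (fun t ht => by simpa using hc t ht) ht
  rw [Real.dist_eq]
  linarith

/-- **THE WINDOWED HYBRID ⟹ PAIR-CAUCHY (double limit).**  A design parameter `w : ℕ` (the K-INDEPENDENT depth of the
good-class window); for every `w` and every pair `K ≤ K′` a matching modulo constants with remainder
`vol·D w K − log (1 − W w K)` (the hybrid remainder of §2 at window `w`); at FIXED `w` the good-class discrepancy is null,
`D w K → 0` (`K → ∞`); the bad-class weights are eventually below `η w`, with `η w → 0` (`w → ∞`) and `η w < 1`.  THEN for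
every `ε > 0` all pairs beyond some `K₀` match within `ε`: choose the window first (`w` with `−log(1 − η w) ≤ ε∕2`), then
`K₀` (with `vol·D w K ≤ ε∕2` and `W w K ≤ η w`). [folklore] -/
theorem pairCauchy_of_windowedHybrid {D W : ℕ → ℕ → ℝ} {η : ℕ → ℝ}
    (hpair : ∀ w K K' : ℕ, K ≤ K' → ∃ c : ℝ, ∀ t : ℝ, |t| ≤ l₀ →
      |Real.log (Z K' t) - Real.log (Z K t) - c| ≤ vol * D w K - Real.log (1 - W w K))
    (hD : ∀ w, Tendsto (fun K => D w K) atTop (𝓝 0))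
    (hW : ∀ w, ∀ᶠ K in atTop, W w K ≤ η w) (hη1 : ∀ w, η w < 1) (hη : Tendsto η atTop (𝓝 0)) :
    ∀ ε : ℝ, 0 < ε → ∃ K₀ : ℕ, ∀ K K' : ℕ, K₀ ≤ K → K ≤ K' →
      ∃ c : ℝ, ∀ t : ℝ, |t| ≤ l₀ → |Real.log (Z K' t) - Real.log (Z K t) - c| ≤ ε := by
  intro ε hε
  -- Step 1: the window.  `−log(1 − η w) → 0` as `w → ∞`; pick `w` with `−log(1 − η w) < ε∕2`.
  have hlog : Tendsto (fun w => -Real.log (1 - η w)) atTop (𝓝 0) := by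
    have h1 : Tendsto (fun w => 1 - η w) atTop (𝓝 1) := by simpa using hη.const_sub 1
    have := ((Real.continuousAt_log one_ne_zero).tendsto.comp h1).neg
    rw [Function.comp_def, Real.log_one, neg_zero] at this
    exact this
  obtain ⟨w, hw⟩ := (Metric.tendsto_atTop.1 hlog) (ε / 2) (by linarith)
  have hw' := hw w le_rfl
  rw [Real.dist_eq, sub_zero] at hw'
  have hlogw : -Real.log (1 - η w) < ε / 2 := lt_of_le_of_lt (le_abs_self _) hw'
  -- Step 2: `K₀` for this window.
  have hD2 : ∀ᶠ K in atTop, vol * D w K ≤ ε / 2 := by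
    have : Tendsto (fun K => vol * D w K) atTop (𝓝 0) := by simpa using (hD w).const_mul vol
    exact this.eventually (Iic_mem_nhds (by linarith))
  obtain ⟨K₀, hK₀⟩ := eventually_atTop.1 (hD2.and (hW w))
  refine ⟨K₀, fun K K' hK hKK' => ?_⟩
  obtain ⟨c, hc⟩ := hpair w K K' hKK'
  refine ⟨c, fun t ht => (hc t ht).trans ?_⟩
  obtain ⟨hDK, hWK⟩ := hK₀ K hK
  -- monotonicity of `−log(1 − ·)` below `1`
  have hmono : -Real.log (1 - W w K) ≤ -Real.log (1 - η w) := by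
    have h1 : 0 < 1 - η w := by linarith [hη1 w]
    have h2 : 1 - η w ≤ 1 - W w K := by linarith
    exact neg_le_neg (Real.log_le_log h1 h2)
  linarith

end Window

section WindowExit

open Missing T4Continuum T4Assembly

variable {G : Type*} [GaugeGroup G] [MeasurableSpace G] [HaarData G] {O : Type*}

/-- **NODE U6 FROM THE WINDOWED HYBRID.**  Per string: a volume and windowed data as in `pairCauchy_of_windowedHybrid` for
`Z = schemeZ S os` ⟹ `GenFunCauchy S l₀`. [folklore] -/
theorem genFunCauchy_of_windowedHybrid (S : TorusScheme G O) {l₀ : ℝ} (hl₀ : 0 ≤ l₀)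
    (h : ∀ os : List O, ∃ (vol : ℝ) (D W : ℕ → ℕ → ℝ) (η : ℕ → ℝ),
      (∀ w K K' : ℕ, K ≤ K' → ∃ c : ℝ, ∀ t : ℝ, |t| ≤ l₀ →
        |Real.log (T4GenFunBounds.schemeZ S os K' t) - Real.log (T4GenFunBounds.schemeZ S os K t) - c|
          ≤ vol * D w K - Real.log (1 - W w K)) ∧
      (∀ w, Tendsto (fun K => D w K) atTop (𝓝 0)) ∧ (∀ w, ∀ᶠ K in atTop, W w K ≤ η w) ∧ (∀ w, η w < 1) ∧
      Tendsto η atTop (𝓝 0)) :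
    GenFunCauchy S l₀ := by
  intro os t ht
  obtain ⟨vol, D, W, η, hpair, hD, hW, hη1, hη⟩ := h os
  exact cauchySeq_genFun_of_pairCauchy hl₀ (pairCauchy_of_windowedHybrid hpair hD hW hη1 hη) ht

end WindowExit

end Summit.QuantumFields.BalabanUV.T4Continuum.NE7PairwiseCauchyWindow
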